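import Literature.NumberTheory.PAdicHodge.TateAlmostEtaleOrbitSums
import HarnessLib

/-!
# Tate's almost étale lemma — the cyclotomic orbit sums `Σ_{s ∈ A/(A ∩ Stab ζ)} s ω` for `ω ∈ {1, ζ}`

Continuation of `TateAlmostEtaleOrbitSums`.  In a finite normal layer `Ω ∋ ζ = ζ_{p^n}` of `F̄/K₀` with
group `G = Gal(Ω/K₀)`, let `A ≤ G` and `D = A ∩ Stab ζ`.  In the application `A` is the image of the
local group `Gal(F̄/F_∞)` (`F_∞/F` the cyclotomic `ℤ_p`-extension), which acts on the `p`-power roots of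
unity through TORSION elements of `ℤ_p^×`: for `p` odd its image on `ζ_{p^n}` has order prime to `p`,
for `p = 2` it acts by `ζ ↦ ζ^{±1}`.  Under exactly these hypotheses we exhibit `ω ∈ {1, ζ}` with
`‖Σ_{s ∈ A/D} s ω‖ ≥ ‖ζ_{p^{n−1}} − 1‖` (`→ 1`):

* `norm_sum_quotient_one` : `Σ_s s 1 = [A : D]`, of norm `1` when `p ∤ [A : D]`;
* `norm_zeta_add_zeta_inv` (`p = 2`, `n ≥ 3`): `‖ζ + ζ⁻¹‖ = ‖ζ_{2^{n−1}} − 1‖`;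
* `exists_omega_norm_sum_quotient_ge` : the dichotomy packaged.

Combined with `orbitSum_smul_sum_eq` and the almost integral trace-one element `y_D` this yields, for
every `B ≤ A`, an integral `B`-fixed `Y` whose trace to `Ω^A` has absolute value `→ 1`
(`exists_integral_fixed_norm_orbitSum_gt`, the layer form of Tate 1967 §3.2 Prop. 9 over the base
`Ω^A`).  No `sorry`, no definitions.

References: J. Tate, *p-divisible groups* (1967) §3.2 Prop. 9 [Tate1967]; J.-P. Serre, *Local Fields*
Ch. IV §4 (cyclotomic extensions of `ℚ_p`) [SerreLocalFields1979].
-/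

noncomputable section

open scoped Classical
open Polynomial Finset IntermediateField

namespace Literature.NumberTheory.PAdicHodge.TateAlmostEtale

open ValuativeRel CyclotomicTower
open Literature.NumberTheory.GaloisRepresentations
open Literature.NumberTheory.GaloisRepresentations.IsNonarchimedeanLocalField

variable {F : Type} [Field F] [ValuativeRel F] [TopologicalSpace F] [IsNonarchimedeanLocalField F]
  [CharZero F] {p : ℕ} [Fact p.Prime] (hp : valuation F p < 1)
variable (Ω : IntermediateField (PadicBase F p hp) (NormedAlgClosure F))
  [FiniteDimensional (PadicBase F p hp) Ω] [Normal (PadicBase F p hp) Ω]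

/-! ## `ω = 1` -/

omit [Normal (PadicBase F p hp) Ω] in
/-- `Σ_{s ∈ A/D} s 1 = [A : D]`, and its norm is `1` when `p ∤ [A : D]` (`‖p‖ < 1`, ultrametric).
[cite: SerreLocalFields1979, Ch. IV §4 (tame part of Gal(ℚ_p(ζ)/ℚ_p))] -/
theorem norm_sum_quotient_one (A D : Subgroup (Ω ≃ₐ[PadicBase F p hp] Ω))
    (hnd : ¬ p ∣ Fintype.card (A ⧸ D.subgroupOf A)) :
    ‖((∑ s : A ⧸ D.subgroupOf A, ((s.out : A) : Ω ≃ₐ[PadicBase F p hp] Ω) (1 : Ω) : Ω) :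
        NormedAlgClosure F)‖ = 1 := by
  simp only [map_one, Finset.sum_const, Finset.card_univ, nsmul_eq_mul, mul_one]
  push_cast
  refine norm_natCast_eq_one_of_not_dvd (Fact.out : p.Prime) ?_ hnd
  rw [PadicBase.norm_natCast_closure hp]; exact PadicBase.norm_p_lt_one hp

/-! ## `ω = ζ`, `p = 2` -/

/-- For `ζ` a primitive `2^n`-th root of unity with `n ≥ 3`: `−ζ²` is a primitive `2^{n−1}`-th root of
unity. [cite: SerreLocalFields1979, Ch. IV §4] -/
theorem isPrimitiveRoot_neg_sq {n : ℕ} (hn : 3 ≤ n) {ζ : NormedAlgClosure F}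
    (hζ : IsPrimitiveRoot ζ (2 ^ n)) : IsPrimitiveRoot (-ζ ^ 2) (2 ^ (n - 1)) := by
  obtain ⟨k, rfl⟩ : ∃ k, n = k + 3 := ⟨n - 3, by omega⟩
  have hhalf : ζ ^ 2 ^ (k + 2) = -1 := by
    have h2 : IsPrimitiveRoot (ζ ^ 2 ^ (k + 2)) 2 :=
      hζ.pow (pow_pos two_pos _) (by rw [pow_succ (2 : ℕ) (k + 2), mul_comm])
    exact h2.eq_neg_one_of_two_right
  have h1 : (-ζ ^ 2) ^ 2 ^ (k + 2) = 1 := by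
    rw [neg_pow, ← pow_mul, show 2 * 2 ^ (k + 2) = 2 ^ (k + 3) by ring, hζ.pow_eq_one,
      Even.neg_one_pow (by exact ⟨2 ^ (k + 1), by ring⟩), one_mul]
  have h2 : ¬ (-ζ ^ 2) ^ 2 ^ (k + 1) = 1 := by
    rw [neg_pow, ← pow_mul, show 2 * 2 ^ (k + 1) = 2 ^ (k + 2) by ring, hhalf,
      Even.neg_one_pow (by exact ⟨2 ^ k, by ring⟩), one_mul]
    norm_num
  have h3 := orderOf_eq_prime_pow h2 h1
  rw [show k + 3 - 1 = k + 1 + 1 from rfl, ← h3]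
  exact IsPrimitiveRoot.orderOf _

/-- **`‖ζ + ζ⁻¹‖ = ‖ζ_{2^{n−1}} − 1‖`** for `ζ = ζ_{2^n}`, `n ≥ 3`, `p = 2` (`ζ + ζ⁻¹ = −ζ⁻¹(μ − 1)` with
`μ = −ζ²` primitive of order `2^{n−1}`). [cite: SerreLocalFields1979, Ch. IV §4 Prop. 17] -/
theorem norm_zeta_add_zeta_inv (hp2 : p = 2) {n : ℕ} (hn : 3 ≤ n) :
    ‖zeta F p n + (zeta F p n)⁻¹‖ = ‖zeta F p (n - 1) - 1‖ := by
  subst hp2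
  set ζ := zeta F 2 n with hζdef
  have hζ : IsPrimitiveRoot ζ (2 ^ n) := zeta_spec F 2 n
  have hζ0 : ζ ≠ 0 := hζ.ne_zero (pow_pos' n).ne'
  have e : ζ + ζ⁻¹ = -ζ⁻¹ * (-ζ ^ 2 - 1) := by field_simp; ring
  rw [e, norm_mul, norm_neg, norm_inv, hζdef, norm_zeta, inv_one, one_mul,
    norm_sub_one_eq_of_isPrimitiveRoot (isPrimitiveRoot_neg_sq hn hζ)]

/-! ## The dichotomy -/

omit [Normal (PadicBase F p hp) Ω] in
/-- **The cyclotomic orbit sum.**  Let `ζ ∈ Ω` with `(ζ : F̄) = ζ_{p^n}` (`n ≥ 3`), `A ≤ Gal(Ω/K₀)`,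
`D ≤ A` the elements of `A` fixing `ζ`, and assume: for `p` odd, `p ∤ [A : D]`; for `p = 2`, every
`a ∈ A` maps `ζ` to `ζ` or `ζ⁻¹` (the local Galois group of the cyclotomic `ℤ_p`-extension acts on
`μ_{p^∞}` through the torsion of `ℤ_p^×`).  Then some `ω ∈ {1, ζ}` — integral and fixed by `D` — has
`‖ζ_{p^{n−1}} − 1‖ ≤ ‖Σ_{s ∈ A/D} s ω‖`. [cite: Tate1967, §3.2 Prop. 9 (proof, base change to F)] [cite: SerreLocalFields1979, Ch. IV §4 Prop. 16–17] -/
theorem exists_omega_norm_sum_quotient_ge {n : ℕ} (hn : 3 ≤ n) {ζΩ : Ω}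
    (hζ : (ζΩ : NormedAlgClosure F) = zeta F p n) (A D : Subgroup (Ω ≃ₐ[PadicBase F p hp] Ω))
    (hD : ∀ g, g ∈ D ↔ g ∈ A ∧ g ζΩ = ζΩ)
    (hodd : p ≠ 2 → ¬ p ∣ Fintype.card (A ⧸ D.subgroupOf A))
    (htwo : p = 2 → ∀ a ∈ A, a ζΩ = ζΩ ∨ a ζΩ = ζΩ⁻¹) :
    ∃ ω : Ω, ‖(ω : NormedAlgClosure F)‖ ≤ 1 ∧ (∀ d ∈ D, d ω = ω) ∧
      ‖zeta F p (n - 1) - 1‖ ≤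
        ‖((∑ s : A ⧸ D.subgroupOf A, ((s.out : A) : Ω ≃ₐ[PadicBase F p hp] Ω) ω : Ω) :
          NormedAlgClosure F)‖ := by
  have hDA : D ≤ A := fun g hg => ((hD g).mp hg).1
  by_cases hcase : ¬ p ∣ Fintype.card (A ⧸ D.subgroupOf A)
  · -- `ω = 1`
    refine ⟨1, by push_cast; rw [norm_one], fun d _ => map_one d, ?_⟩
    rw [norm_sum_quotient_one hp Ω A D hcase]
    exact norm_zeta_sub_one_le_one _
  · -- `p ∣ [A : D]`: then `p = 2` and some `a₀ ∈ A` inverts `ζ`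
    push Not at hcase
    have hp2 : p = 2 := by
      by_contra h; exact hodd h hcase
    have hζΩ0 : ζΩ ≠ 0 := by
      intro h; rw [h] at hζ; push_cast at hζ
      exact (zeta_spec F p n).ne_zero (pow_pos' n).ne' hζ.symm
    -- injectivity of `s ↦ s.out ζ` on `A/D`
    have hinj : Function.Injective fun s : A ⧸ D.subgroupOf A =>
        ((s.out : A) : Ω ≃ₐ[PadicBase F p hp] Ω) ζΩ := by
      intro s s' h
      dsimp only at h
      rw [← QuotientGroup.out_eq' s, ← QuotientGroup.out_eq' s', QuotientGroup.eq,
        Subgroup.mem_subgroupOf, hD]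
      refine ⟨A.mul_mem (A.inv_mem s.out.2) s'.out.2, ?_⟩
      change (((s.out : A) : Ω ≃ₐ[PadicBase F p hp] Ω)⁻¹ * ((s'.out : A) : Ω ≃ₐ[PadicBase F p hp] Ω)) ζΩ = ζΩ
      rw [AlgEquiv.mul_apply, ← h, ← AlgEquiv.mul_apply, inv_mul_cancel, AlgEquiv.one_apply]
    -- the image is `{ζ, ζ⁻¹}` and has `[A:D] ≥ 2` elements
    have himage : ∀ s : A ⧸ D.subgroupOf A,
        ((s.out : A) : Ω ≃ₐ[PadicBase F p hp] Ω) ζΩ = ζΩ ∨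
          ((s.out : A) : Ω ≃ₐ[PadicBase F p hp] Ω) ζΩ = ζΩ⁻¹ := fun s => htwo hp2 _ s.out.2
    have hcard2 : 2 ≤ Fintype.card (A ⧸ D.subgroupOf A) :=
      Nat.le_of_dvd Fintype.card_pos (hp2 ▸ hcase)
    have hne : ζΩ ≠ ζΩ⁻¹ := by
      intro h
      -- then all values coincide, contradicting `[A:D] ≥ 2` and injectivity
      have : ∀ s s' : A ⧸ D.subgroupOf A, s = s' := fun s s' => hinj (by
        rcases himage s with h1 | h1 <;> rcases himage s' with h2 | h2 <;> simp only [h1, h2, ← h])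
      have h1 : Fintype.card (A ⧸ D.subgroupOf A) ≤ 1 := Fintype.card_le_one_iff.mpr this
      omega
    -- the sum is `ζ + ζ⁻¹`
    set f : A ⧸ D.subgroupOf A → Ω := fun s => ((s.out : A) : Ω ≃ₐ[PadicBase F p hp] Ω) ζΩ with hf
    have himg : (Finset.univ : Finset (A ⧸ D.subgroupOf A)).image f = {ζΩ, ζΩ⁻¹} := by
      apply Finset.eq_of_subset_of_card_le
      · intro v hv
        obtain ⟨s, -, rfl⟩ := Finset.mem_image.mp hv
        rcases himage s with h | h
        · rw [Finset.mem_insert]; exact Or.inl h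
        · rw [Finset.mem_insert, Finset.mem_singleton]; exact Or.inr h
      · rw [Finset.card_pair hne, Finset.card_image_of_injective _ hinj, Finset.card_univ]
        exact hcard2
    have hsum : ∑ s : A ⧸ D.subgroupOf A, ((s.out : A) : Ω ≃ₐ[PadicBase F p hp] Ω) ζΩ = ζΩ + ζΩ⁻¹ := by
      have h := Finset.sum_image (f := fun v : Ω => v) (s := (Finset.univ : Finset (A ⧸ D.subgroupOf A)))
        (g := f) (fun x _ y _ hxy => hinj hxy)
      rw [himg, Finset.sum_pair hne] at h
      rw [← h]
    refine ⟨ζΩ, by rw [hζ, norm_zeta], fun d hd => ((hD d).mp hd).2, ?_⟩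
    rw [hsum]
    push_cast
    rw [hζ, norm_zeta_add_zeta_inv hp2 hn]

/-! ## The layer form of Tate's theorem over the fixed field of `A` -/

/-- **Tate's almost étale lemma in the layer `Ω = K₀(ζ_{p^n}, y₀)`, over the fixed field of an arbitrary
subgroup `A`.**  Hypotheses as in `gauge_gt_of_layer` (`x` an integral generator of `𝒪_Ω` with
`y₀ = P(x)`, `C = Stab y₀`, `H = Stab ζ`, `H ∩ C = 1`, `J`, `D'`, `m` with `‖p‖^{m−1} < J^{D'}`), `n ≥ 3`,
plus: `B ≤ A ≤ G`, the torsion-type hypotheses on the action of `A` on `ζ` (`p` odd: `p ∤ [A : A ∩ H]`;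
`p = 2`: `A` acts on `ζ` by `±1`), and an `A`-fixed `λ ∈ Ω` with `‖λ‖ ≤ ‖ζ_{p^{n−m}} − 1‖^{|H|−1}`.  Then
there is an INTEGRAL `Y ∈ Ω` fixed by `B` with `‖λ‖ · ‖ζ_{p^{n−1}} − 1‖ ≤ ‖Σ_{q ∈ A/B} q Y‖` (the trace
of `Y` from `Ω^B` to `Ω^A`).  As `n → ∞` both `‖λ‖` and `‖ζ_{p^{n−1}} − 1‖` can be taken `→ 1`:
`Tr(𝒪_{Ω^B}) ⊇ 𝔪_{Ω^A}` asymptotically — Tate 1967 §3.2 Prop. 9 over the base `Ω^A`.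
[cite: Tate1967, §3.2 Prop. 9] [cite: SerreLocalFields1979, Ch. IV §1 Prop. 3, Ch. III §6 Lemma 2] -/
theorem exists_integral_fixed_norm_orbitSum_ge {x : Ω} (hx : ‖(x : NormedAlgClosure F)‖ ≤ 1)
    (hfree : ∀ g : Ω ≃ₐ[PadicBase F p hp] Ω, g x = x → g = 1)
    {y₀ : Ω} (P : (PadicBase F p hp)[X]) (hP : ∀ j, ‖P.coeff j‖ ≤ 1) (hPy : aeval x P = y₀)
    (C : Subgroup (Ω ≃ₐ[PadicBase F p hp] Ω)) (hC : ∀ g, g ∈ C ↔ g y₀ = y₀)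
    {n : ℕ} (hn3 : 3 ≤ n) {ζΩ : Ω} (hζ : (ζΩ : NormedAlgClosure F) = zeta F p n)
    (H : Subgroup (Ω ≃ₐ[PadicBase F p hp] Ω)) (hH : ∀ g, g ∈ H ↔ g ζΩ = ζΩ)
    (hHC : ∀ g : Ω ≃ₐ[PadicBase F p hp] Ω, g ζΩ = ζΩ → g y₀ = y₀ → g = 1)
    {J : ℝ} (hJ0 : 0 ≤ J) (hJ1 : J ≤ 1)
    (hJ : ∀ σ : Ω ≃ₐ[PadicBase F p hp] Ω, σ y₀ ≠ y₀ →
      J ≤ ‖((σ y₀ : Ω) : NormedAlgClosure F) - y₀‖)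
    {D' : ℕ} (hD' : Fintype.card ((Ω ≃ₐ[PadicBase F p hp] Ω) ⧸ C) ≤ D')
    {m : ℕ} (hm : 1 ≤ m) (hmn : m + 1 ≤ n)
    (hsmall : ‖(p : PadicBase F p hp)‖ ^ (m - 1) < J ^ D')
    (A B : Subgroup (Ω ≃ₐ[PadicBase F p hp] Ω)) (hBA : B ≤ A)
    (hodd : p ≠ 2 → ¬ p ∣ Fintype.card (A ⧸ (A ⊓ H).subgroupOf A))
    (htwo : p = 2 → ∀ a ∈ A, a ζΩ = ζΩ ∨ a ζΩ = ζΩ⁻¹)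
    {lam : Ω} (hlamA : ∀ a ∈ A, a lam = lam)
    (hlam : ‖(lam : NormedAlgClosure F)‖ ≤ ‖zeta F p (n - m) - 1‖ ^ (Fintype.card H - 1)) :
    ∃ Y : Ω, ‖(Y : NormedAlgClosure F)‖ ≤ 1 ∧ (∀ b ∈ B, b Y = Y) ∧
      ‖(lam : NormedAlgClosure F)‖ * ‖zeta F p (n - 1) - 1‖ ≤
        ‖((∑ q : A ⧸ B.subgroupOf A, ((q.out : A) : Ω ≃ₐ[PadicBase F p hp] Ω) Y : Ω) :
          NormedAlgClosure F)‖ := by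
  set D : Subgroup (Ω ≃ₐ[PadicBase F p hp] Ω) := A ⊓ H with hDdef
  have hD : ∀ g, g ∈ D ↔ g ∈ A ∧ g ζΩ = ζΩ := fun g => by rw [hDdef, Subgroup.mem_inf, hH]
  have hDA : D ≤ A := inf_le_left
  have hDH : D ≤ H := inf_le_right
  set U : ℝ := ‖zeta F p (n - m) - 1‖ with hU
  have hU0 : 0 < U := norm_zeta_sub_one_pos (by omega)
  have hU1 : U ≤ 1 := norm_zeta_sub_one_le_one _
  -- the cyclotomic sum
  obtain ⟨ω, hω1, hωD, hωsum⟩ := exists_omega_norm_sum_quotient_ge hp Ω hn3 hζ A D hD hodd htwo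
  -- the trace-one element for `D`
  set yD : Ω := x ^ (Fintype.card D - 1) /
      ∏ d ∈ (Finset.univ : Finset D).erase 1, (x - (d : Ω ≃ₐ[PadicBase F p hp] Ω) x) with hyD
  have hyD1 : ∑ d : D, (d : Ω ≃ₐ[PadicBase F p hp] Ω) yD = 1 :=
    sum_gal_traceOneElt_eq_one hp Ω x D fun d _ hd => hfree d hd
  have hyDnorm : ‖(yD : NormedAlgClosure F)‖ * U ^ (Fintype.card D - 1) ≤ 1 :=
    norm_traceOneElt_mul_pow_le_one' hp Ω hx hfree P hP hPy C hC hζ H hH hHC hJ0 hJ1 hJ hD' hm hmn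
      hsmall D hDH
  -- `w = λ ω y_D` is integral
  have hcardDH : Fintype.card D - 1 ≤ Fintype.card H - 1 :=
    Nat.sub_le_sub_right (Fintype.card_le_of_injective (Subgroup.inclusion hDH)
      (Subgroup.inclusion_injective hDH)) 1
  have hw : ‖((lam * ω * yD : Ω) : NormedAlgClosure F)‖ ≤ 1 := by
    push_cast
    rw [norm_mul, norm_mul]
    calc ‖(lam : NormedAlgClosure F)‖ * ‖(ω : NormedAlgClosure F)‖ * ‖(yD : NormedAlgClosure F)‖
        ≤ U ^ (Fintype.card H - 1) * 1 * ‖(yD : NormedAlgClosure F)‖ := by gcongr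
      _ ≤ U ^ (Fintype.card D - 1) * ‖(yD : NormedAlgClosure F)‖ := by
          rw [mul_one]
          exact mul_le_mul_of_nonneg_right (pow_le_pow_of_le_one hU0.le hU1 hcardDH) (norm_nonneg _)
      _ = ‖(yD : NormedAlgClosure F)‖ * U ^ (Fintype.card D - 1) := mul_comm _ _
      _ ≤ 1 := hyDnorm
  refine ⟨∑ b : B, (b : Ω ≃ₐ[PadicBase F p hp] Ω) (lam * ω * yD), norm_sum_subgroup_le_one hp Ω B hw,
    fun b hb => gal_sum_subgroup_eq hp Ω B _ hb, ?_⟩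
  rw [orbitSum_smul_sum_eq hp Ω A B D hBA hDA hlamA hωD hyD1]
  push_cast
  rw [norm_mul]
  have e : ((∑ s : A ⧸ D.subgroupOf A, ((s.out : A) : Ω ≃ₐ[PadicBase F p hp] Ω) ω : Ω) :
      NormedAlgClosure F) = ∑ s : A ⧸ D.subgroupOf A,
        ((((s.out : A) : Ω ≃ₐ[PadicBase F p hp] Ω) ω : Ω) : NormedAlgClosure F) := by push_cast; rfl
  rw [← e]
  exact mul_le_mul_of_nonneg_left hωsum (norm_nonneg _)

end Literature.NumberTheory.PAdicHodge.TateAlmostEtale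

end
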